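import Literature.Barriers.ValiantsHypothesis.BIJL18PermanentZero
import Literature.Computability.AlgebraicComplexity.CharacterizedByStabilizer
import Literature.Computability.AlgebraicComplexity.PerStabilizerMarcusMay
import Literature.Computability.AlgebraicComplexity.StandardFamiliesProofs

/-!
# Bläser–Ikenmeyer–Jindal–Lysikov 2018, Proposition 26 and Theorem 7 — PROVED

Discharge of the named facts `BIJL2018_prop26` and `BIJL2018_thm7` of `BIJL18PermanentZero.lean`
(val-lit row BIJL2018-B; M. Bläser, C. Ikenmeyer, G. Jindal, V. Lysikov, *Generalized matrix
completion and algebraic natural proofs*, STOC 2018 / ECCC TR18-064, §7): for the group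
`G = Q_n × Q_n` of pairs of monomial matrices acting on `ℂ^{n×n}` by `(g₁, g₂)·A = g₁ A g₂ᵀ` and
the one-dimensional type `ν` with character `χ_ν(g) = per g₁ · per g₂`,
`mult_ν(ℂ[Z]_n) = 0` for the permanent hypersurface `Z`, and `mult_ν(ℂ[GA]_n)` is `0` if
`per A = 0` and `1` otherwise [cite: BlaserIkenmeyerJindalLysikov2018, Prop. 26]; consequently a
polynomial-size occurrence obstruction against `per = 0` exists
[cite: BlaserIkenmeyerJindalLysikov2018, Thm. 7].

Proof, following the print (ECCC p. 21–22, "`W := (ℂ[ℂ^{n×n}]_n)_ν` … `W` is spanned by the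
permanent polynomial"), with the tree's elementary characterisation of the permanent by its
monomial symmetries in place of Schur–Weyl duality / Gay's theorem:

* `permanent_gAct` — `per(g₁ A g₂ᵀ) = per g₁ · per A · per g₂` for monomial `g₁, g₂`
  (`MarcusMay.permanent_sandwich`); the same identity for the generic matrix gives
  `perPoly ∈ W_n` (`perPoly_mem_semiInvNu`).
* `semiInvNu_eq_span` — `W_n = ℂ · per_n`: a semi-invariant form of degree `n` is FIXED by the
  torus scalings `X_{ab} ↦ 2^{[a=a₀]} 2^{-[b=b₀]} X_{ab}` and by the row permutations (their
  character is `1`), hence is a multiple of `per_n`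
  (`CharacterizedByStabilizer.perPoly_eq_smul_of_fixed_of_monomial`).
* `multNu_eq_zero_of_forall` / `multNu_eq_one_of_exists` — with `W_n` a line,
  `mult_ν = dim W_n − dim(W_n ∩ I(Y))` is `0` iff `per_n` vanishes on `Y` and `1` otherwise;
  `per_n` vanishes on `Z` by definition and on `GA` iff `per A = 0` (take `g = (1,1)`).

Theorem-only file. Honest framing: a discharge of typed literature (net debt −2) — a toy
occurrence obstruction inside GCT's formalism, as the source stresses ("while it is a short
proof, its verification is hard"); VP ≠ VNP is NOT proved and nothing here is progress on it.

## References
* [BlaserIkenmeyerJindalLysikov2018] M. Bläser, C. Ikenmeyer, G. Jindal, V. Lysikov, STOC 2018,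
  doi:10.1145/3188745.3188832; ECCC TR18-064, §7, Prop. 26 and Thm. 7 (p. 20–22).
* [MulmuleySohoniGCT2SIAM2008] K. Mulmuley, M. Sohoni, GCT II, SIAM J. Comput. 38 (2008),
  Thm. 2.3 (the permanent is characterized by its stabilizer; tree
  `CharacterizedByStabilizer.lean`).
* [Minc1978] H. Minc, *Permanents*, Ch. 2, Thm. 1.1 (monomial sandwiches; tree
  `PerStabilizerMarcusMay.lean`).
-/

noncomputable section

open MvPolynomial Matrix
open scoped BigOperators

namespace Literature.Barriers.ValiantsHypothesis

open Literature.Computability.AlgebraicComplexity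

namespace Prop26

variable {n : ℕ}

/-! ### Monomial matrices as `diagonal × permutation` -/

/-- A monomial matrix `(i, j) ↦ [i = π j] d_j` over any commutative ring is
`diag(d ∘ π⁻¹) · P_{π⁻¹}`. [cite: BlaserIkenmeyerJindalLysikov2018, §7 (the group `Q_n`)] -/
theorem of_monomial_eq_diagonal_mul {R : Type*} [CommRing R] (π : Equiv.Perm (Fin n))
    (d : Fin n → R) :
    (Matrix.of fun i j : Fin n => if i = π j then d j else 0) =
      Matrix.diagonal (fun i => d (π.symm i)) * (π⁻¹).permMatrix R := by
  ext i j
  simp only [Matrix.of_apply, Matrix.diagonal_mul, Equiv.Perm.permMatrix, PEquiv.toMatrix_apply,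
    Equiv.toPEquiv_apply, Option.mem_def, Option.some.injEq, mul_ite, mul_one, mul_zero]
  by_cases h : i = π j
  · subst h
    simp
  · rw [if_neg h, if_neg]
    intro h'
    apply h
    rw [← h']
    simp

/-- Its transpose is `P_π · diag(d ∘ π⁻¹)`. [cite: BlaserIkenmeyerJindalLysikov2018, §7 (the group `Q_n`)] -/
theorem transpose_of_monomial_eq {R : Type*} [CommRing R] (π : Equiv.Perm (Fin n))
    (d : Fin n → R) :
    (Matrix.of fun i j : Fin n => if i = π j then d j else 0)ᵀ =
      π.permMatrix R * Matrix.diagonal (fun i => d (π.symm i)) := by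
  rw [of_monomial_eq_diagonal_mul, Matrix.transpose_mul, Matrix.diagonal_transpose,
    Matrix.transpose_permMatrix, inv_inv]

/-- The tree's `monomialMat` is the matrix `(i, j) ↦ [i = π j] α_j`.
[cite: BlaserIkenmeyerJindalLysikov2018, §7 (the group `Q_n`)] -/
theorem monomialMat_eq_of (π : Equiv.Perm (Fin n)) (α : Fin n → ℂ) :
    monomialMat n π α = Matrix.of fun i j : Fin n => if i = π j then α j else 0 := rfl

/-- Permanent of a monomial matrix: `per (P_π diag α) = ∏ α`.
[cite: BlaserIkenmeyerJindalLysikov2018, §7 (the type ν: "the tori act by rescaling")] -/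
theorem permanent_monomialMat (π : Equiv.Perm (Fin n)) (α : Fin n → ℂ) :
    (monomialMat n π α).permanent = ∏ j, α j := by
  rw [monomialMat_eq_of, of_monomial_eq_diagonal_mul, MarcusMay.permanent_diagonal_mul,
    ← Matrix.mul_one ((π⁻¹).permMatrix ℂ), MarcusMay.permanent_permMatrix_mul,
    Matrix.permanent_one, mul_one]
  exact Equiv.prod_comp π.symm α

/-- **`per(g₁ A g₂ᵀ) = per g₁ · per g₂ · per A`** for `g = (g₁, g₂) ∈ Q_n × Q_n` (monomial
sandwiches rescale the permanent). [cite: BlaserIkenmeyerJindalLysikov2018, Prop. 26 (proof)] -/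
theorem permanent_gAct {g : Matrix (Fin n) (Fin n) ℂ × Matrix (Fin n) (Fin n) ℂ}
    (hg : g ∈ bijlG n) (A : Matrix (Fin n) (Fin n) ℂ) :
    (gAct n g A).permanent = charNu n g * A.permanent := by
  obtain ⟨⟨π, α, -, h1⟩, ⟨σ, β, -, h2⟩⟩ := hg
  rw [gAct, charNu, h1, h2, permanent_monomialMat, permanent_monomialMat, monomialMat_eq_of,
    monomialMat_eq_of, of_monomial_eq_diagonal_mul, transpose_of_monomial_eq]
  rw [show Matrix.diagonal (fun i => α (π.symm i)) * (π⁻¹).permMatrix ℂ * A *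
      (σ.permMatrix ℂ * Matrix.diagonal fun i => β (σ.symm i)) =
      Matrix.diagonal (fun i => α (π.symm i)) * (π⁻¹).permMatrix ℂ * A * σ.permMatrix ℂ *
        Matrix.diagonal (fun i => β (σ.symm i)) by simp only [Matrix.mul_assoc],
    MarcusMay.permanent_sandwich, Equiv.prod_comp π.symm α, Equiv.prod_comp σ.symm β]

/-- The identity `(1, 1) ∈ G`. [cite: BlaserIkenmeyerJindalLysikov2018, §7 (the group `Q_n`)] -/
theorem one_mem_Qn : (1 : Matrix (Fin n) (Fin n) ℂ) ∈ Qn n := by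
  refine ⟨1, fun _ => 1, fun _ => one_ne_zero, ?_⟩
  ext i j
  simp [monomialMat, Matrix.one_apply]

/-- `A ∈ GA`. [cite: BlaserIkenmeyerJindalLysikov2018, §7] -/
theorem self_mem_gOrbit (A : Matrix (Fin n) (Fin n) ℂ) : A ∈ gOrbit n A :=
  ⟨(1, 1), ⟨one_mem_Qn, one_mem_Qn⟩, by simp [gAct]⟩

/-! ### The permanent is `ν`-semi-invariant -/

/-- Membership in the semi-invariant space, unfolded. [cite: BlaserIkenmeyerJindalLysikov2018, Prop. 26 (proof)] -/
theorem mem_semiInvNu_iff {d : ℕ} {f : MvPolynomial (Fin n × Fin n) ℂ} :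
    f ∈ semiInvNu n d ↔ f.IsHomogeneous d ∧ ∀ g ∈ bijlG n, gActPoly n g f = charNu n g • f :=
  Iff.rfl

/-- Membership in the vanishing ideal, unfolded. [cite: BlaserIkenmeyerJindalLysikov2018, §7] -/
theorem mem_matVanishingIdeal_iff {Y : Set (Matrix (Fin n) (Fin n) ℂ)}
    {f : MvPolynomial (Fin n × Fin n) ℂ} :
    f ∈ matVanishingIdeal n Y ↔ ∀ B ∈ Y, eval (fun ij : Fin n × Fin n => B ij.1 ij.2) f = 0 :=
  Iff.rfl

/-- `per_n` vanishes on `Y` iff every matrix of `Y` has permanent zero.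
[cite: BlaserIkenmeyerJindalLysikov2018, Prop. 26 (proof)] -/
theorem perPoly_mem_matVanishingIdeal_iff {Y : Set (Matrix (Fin n) (Fin n) ℂ)} :
    perPoly (Fin n) ℂ ∈ matVanishingIdeal n Y ↔ ∀ B ∈ Y, B.permanent = 0 := by
  rw [mem_matVanishingIdeal_iff]
  refine forall₂_congr fun B _ => ?_
  rw [eval_perPoly]
  rfl

/-- The action of `g = (g₁, g₂)` on the generic permanent: `g · per = per(g₁ᵀ X g₂)`.
[cite: BlaserIkenmeyerJindalLysikov2018, §7 (canonical pullback)] -/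
theorem gActPoly_perPoly (g : Matrix (Fin n) (Fin n) ℂ × Matrix (Fin n) (Fin n) ℂ) :
    gActPoly n g (perPoly (Fin n) ℂ) =
      ((g.1.map C)ᵀ * Matrix.mvPolynomialX (Fin n) (Fin n) ℂ * g.2.map C).permanent := by
  rw [gActPoly, perPoly]
  simp only [Matrix.permanent, map_sum, map_prod, aeval_X, Matrix.mvPolynomialX_apply]
  refine Finset.sum_congr rfl fun τ _ => Finset.prod_congr rfl fun i _ => ?_
  simp only [Matrix.mul_apply, Matrix.transpose_apply, Matrix.map_apply,
    Matrix.mvPolynomialX_apply, Finset.sum_mul]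
  rw [Finset.sum_comm]
  refine Finset.sum_congr rfl fun l _ => ?_
  refine Finset.sum_congr rfl fun k _ => ?_
  rw [map_mul]
  ring

/-- `(P_π diag α).map C` is again of monomial shape. [cite: BlaserIkenmeyerJindalLysikov2018, §7] -/
theorem map_monomialMat (π : Equiv.Perm (Fin n)) (α : Fin n → ℂ) :
    (monomialMat n π α).map (C : ℂ →+* MvPolynomial (Fin n × Fin n) ℂ) =
      Matrix.of fun i j : Fin n => if i = π j then C (α j) else 0 := by
  ext i j
  simp only [Matrix.map_apply, monomialMat, Matrix.of_apply, apply_ite C, map_zero]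

/-- **`per_n ∈ W_n`**: `g · per_n = per(g₁) per(g₂) · per_n` for `g ∈ Q_n × Q_n`.
[cite: BlaserIkenmeyerJindalLysikov2018, Prop. 26 (proof)] -/
theorem perPoly_mem_semiInvNu : perPoly (Fin n) ℂ ∈ semiInvNu n n := by
  refine ⟨by simpa using perPoly_isHomogeneous (n := Fin n) (k := ℂ), fun g hg => ?_⟩
  obtain ⟨⟨π, α, -, h1⟩, ⟨σ, β, -, h2⟩⟩ := hg
  rw [gActPoly_perPoly, charNu, h1, h2, permanent_monomialMat, permanent_monomialMat,
    map_monomialMat, map_monomialMat, transpose_of_monomial_eq, of_monomial_eq_diagonal_mul,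
    show π.permMatrix _ * Matrix.diagonal (fun i => C (α (π.symm i))) *
        Matrix.mvPolynomialX (Fin n) (Fin n) ℂ *
        (Matrix.diagonal (fun i => C (β (σ.symm i))) * (σ⁻¹).permMatrix _) =
      π.permMatrix _ * (Matrix.diagonal (fun i => C (α (π.symm i))) *
        (Matrix.mvPolynomialX (Fin n) (Fin n) ℂ * Matrix.diagonal (fun i => C (β (σ.symm i))) *
        (σ⁻¹).permMatrix _)) by simp only [Matrix.mul_assoc],
    MarcusMay.permanent_permMatrix_mul, MarcusMay.permanent_diagonal_mul,
    MarcusMay.permanent_mul_permMatrix, MarcusMay.permanent_mul_diagonal, ← perPoly,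
    Equiv.prod_comp π.symm (fun i => C (α i)), Equiv.prod_comp σ.symm (fun i => C (β i)),
    ← map_prod, ← map_prod, MvPolynomial.smul_eq_C_mul, map_mul]
  ring

/-! ### `W_n = ℂ · per_n` -/

/-- The torus scaling by `α_i β_j` is the substitution `g · f` for
`g = (diag α, diag β)`. [cite: BlaserIkenmeyerJindalLysikov2018, §7 (canonical pullback)] -/
theorem gActPoly_diagonal (α β : Fin n → ℂ) :
    gActPoly n (monomialMat n 1 α, monomialMat n 1 β) =
      linSubst (Fin n × Fin n) ℂ (Matrix.diagonal fun x : Fin n × Fin n => α x.1 * β x.2) := by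
  refine MvPolynomial.algHom_ext fun ij => ?_
  rw [gActPoly, aeval_X, linSubst_X]
  rcases ij with ⟨i, j⟩
  simp only [monomialMat, Equiv.Perm.coe_one, id_eq, Matrix.diagonal_apply,
    ite_smul, zero_smul]
  rw [Finset.sum_eq_single i, Finset.sum_eq_single j]
  · simp [MvPolynomial.smul_eq_C_mul, Finset.sum_ite_eq']
  · intro l _ hl
    simp [hl]
  · simp
  · intro k _ hk
    exact Finset.sum_eq_zero fun l _ => by simp [hk]
  · simp

/-- The row permutation `X_{ij} ↦ X_{τ i, j}` is the substitution `g · f` for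
`g = (P_τ, 1)`. [cite: BlaserIkenmeyerJindalLysikov2018, §7 (canonical pullback)] -/
theorem gActPoly_rowPerm (τ : Equiv.Perm (Fin n)) :
    gActPoly n (monomialMat n τ (fun _ => 1), monomialMat n 1 (fun _ => 1)) =
      (rename fun x : Fin n × Fin n => (τ x.1, x.2) :
        MvPolynomial (Fin n × Fin n) ℂ →ₐ[ℂ] MvPolynomial (Fin n × Fin n) ℂ) := by
  refine MvPolynomial.algHom_ext fun ij => ?_
  rw [gActPoly, aeval_X, rename_X]
  rcases ij with ⟨i, j⟩
  simp only [monomialMat, Equiv.Perm.coe_one, id_eq]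
  rw [Finset.sum_eq_single (τ i), Finset.sum_eq_single j]
  · simp
  · intro l _ hl
    simp [hl]
  · simp
  · intro k _ hk
    exact Finset.sum_eq_zero fun l _ => by simp [hk]
  · simp

/-- **`W_n ≤ ℂ · per_n`**: a `ν`-semi-invariant form of degree `n` is a multiple of the
permanent. [cite: BlaserIkenmeyerJindalLysikov2018, Prop. 26 (proof: "W is spanned by the permanent")] -/
theorem semiInvNu_le_span : semiInvNu n n ≤ ℂ ∙ perPoly (Fin n) ℂ := by
  intro f hf
  rw [mem_semiInvNu_iff] at hf
  obtain ⟨hhom, hsemi⟩ := hf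
  have hQ : ∀ γ : Fin n → ℂ, (∀ j, γ j ≠ 0) → ∀ π : Equiv.Perm (Fin n),
      monomialMat n π γ ∈ Qn n := fun γ hγ π => ⟨π, γ, hγ, rfl⟩
  -- torus scalings with character 1 fix `f`
  have hdiag : ∀ a b : Fin n, linSubst _ ℂ (Matrix.diagonal fun x : Fin n × Fin n =>
      (if x.1 = a then (2 : ℂ) else 1) * (if x.2 = b then (2 : ℂ)⁻¹ else 1)) f = f := by
    intro a b
    set α : Fin n → ℂ := fun i => if i = a then 2 else 1 with hα
    set β : Fin n → ℂ := fun j => if j = b then 2⁻¹ else 1 with hβ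
    have hαne : ∀ i, α i ≠ 0 := fun i => by rw [hα]; dsimp only; split_ifs <;> norm_num
    have hβne : ∀ j, β j ≠ 0 := fun j => by rw [hβ]; dsimp only; split_ifs <;> norm_num
    have h := hsemi (monomialMat n 1 α, monomialMat n 1 β) ⟨hQ α hαne 1, hQ β hβne 1⟩
    have hchar : charNu n (monomialMat n 1 α, monomialMat n 1 β) = 1 := by
      rw [charNu, permanent_monomialMat, permanent_monomialMat, hα, hβ]
      simp [Finset.prod_ite_eq']
    rw [hchar, one_smul, gActPoly_diagonal] at h
    exact h
  -- row permutations with character 1 fix `f`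
  have hperm : ∀ τ : Equiv.Perm (Fin n), rename (fun x : Fin n × Fin n => (τ x.1, x.2)) f = f := by
    intro τ
    have h := hsemi (monomialMat n τ (fun _ => 1), monomialMat n 1 (fun _ => 1))
      ⟨hQ _ (fun _ => one_ne_zero) τ, hQ _ (fun _ => one_ne_zero) 1⟩
    have hchar : charNu n (monomialMat n τ (fun _ => (1 : ℂ)), monomialMat n 1 (fun _ => (1 : ℂ))) = 1 := by
      rw [charNu, permanent_monomialMat, permanent_monomialMat]
      simp
    rw [hchar, one_smul, gActPoly_rowPerm] at h
    exact h
  obtain ⟨c, hc⟩ :=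
    CharacterizedByStabilizer.perPoly_eq_smul_of_fixed_of_monomial f hhom hdiag hperm
  exact Submodule.mem_span_singleton.2 ⟨c, hc.symm⟩

/-- **`W_n = ℂ · per_n`** ("`W` is spanned by the permanent polynomial", ECCC p. 22).
[cite: BlaserIkenmeyerJindalLysikov2018, Prop. 26 (proof)] -/
theorem semiInvNu_eq_span : semiInvNu n n = ℂ ∙ perPoly (Fin n) ℂ :=
  le_antisymm semiInvNu_le_span ((Submodule.span_singleton_le_iff_mem _ _).2 perPoly_mem_semiInvNu)

/-- `dim W_n = 1`. [cite: BlaserIkenmeyerJindalLysikov2018, Prop. 26 (proof)] -/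
theorem finrank_semiInvNu : Module.finrank ℂ (semiInvNu n n) = 1 := by
  rw [semiInvNu_eq_span]
  exact finrank_span_singleton (perPoly_ne_zero (Fin n) ℂ)

/-! ### The multiplicities -/

/-- If `per_n` vanishes on `Y` then `mult_ν(ℂ[Y]_n) = 0` ("all elements in `W` vanish on `Y`").
[cite: BlaserIkenmeyerJindalLysikov2018, Prop. 26 (proof)] -/
theorem multNu_eq_zero_of_forall {Y : Set (Matrix (Fin n) (Fin n) ℂ)}
    (hY : ∀ B ∈ Y, B.permanent = 0) : multNu n Y n = 0 := by
  have hle : semiInvNu n n ≤ (matVanishingIdeal n Y).restrictScalars ℂ := by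
    rw [semiInvNu_eq_span, Submodule.span_singleton_le_iff_mem, Submodule.restrictScalars_mem]
    exact perPoly_mem_matVanishingIdeal_iff.2 hY
  rw [multNu, inf_of_le_left hle, Nat.sub_self]

/-- If `per_n` does not vanish at some point of `Y` then `mult_ν(ℂ[Y]_n) = 1`.
[cite: BlaserIkenmeyerJindalLysikov2018, Prop. 26 (proof)] -/
theorem multNu_eq_one_of_exists {Y : Set (Matrix (Fin n) (Fin n) ℂ)}
    (hY : ∃ B ∈ Y, B.permanent ≠ 0) : multNu n Y n = 1 := by
  have hbot : semiInvNu n n ⊓ (matVanishingIdeal n Y).restrictScalars ℂ = ⊥ := by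
    rw [eq_bot_iff]
    intro f hf
    rw [Submodule.mem_inf, semiInvNu_eq_span, Submodule.mem_span_singleton,
      Submodule.restrictScalars_mem] at hf
    obtain ⟨⟨c, rfl⟩, hI⟩ := hf
    rw [Submodule.mem_bot]
    by_cases hc : c = 0
    · rw [hc, zero_smul]
    · exfalso
      obtain ⟨B, hB, hper⟩ := hY
      have h1 := (mem_matVanishingIdeal_iff.1 hI) B hB
      rw [smul_eval, eval_perPoly] at h1
      exact hper ((mul_eq_zero.1 h1).resolve_left hc)
  rw [multNu, hbot, finrank_bot, finrank_semiInvNu]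

end Prop26

open Prop26

/-! ### Proposition 26 and Theorem 7 -/

/-- **BIJL 2018, Proposition 26 holds**: `mult_ν(ℂ[Z]_n) = 0`; `mult_ν(ℂ[GA]_n) = 0` if
`A ∈ Z` and `= 1` otherwise. Discharge of the named fact `BIJL2018_prop26`.
[cite: BlaserIkenmeyerJindalLysikov2018, Prop. 26] -/
theorem BIJL2018_prop26_holds : BIJL2018_prop26 := by
  intro n
  refine ⟨multNu_eq_zero_of_forall fun B hB => hB, fun A => ⟨fun hA => ?_, fun hA => ?_⟩⟩
  · refine multNu_eq_zero_of_forall fun B hB => ?_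
    obtain ⟨g, hg, rfl⟩ := hB
    rw [permanent_gAct hg, show A.permanent = 0 from hA, mul_zero]
  · exact multNu_eq_one_of_exists ⟨A, self_mem_gOrbit A, hA⟩

/-- **BIJL 2018, Theorem 7 holds** ("there is a polynomial sized occurrence obstruction
against the set of matrices with permanent zero"): immediate from Proposition 26
(`BIJL2018_thm7_of_prop26`). Discharge of the named fact `BIJL2018_thm7`.
[cite: BlaserIkenmeyerJindalLysikov2018, Thm. 7] -/
theorem BIJL2018_thm7_holds : BIJL2018_thm7 :=
  BIJL2018_thm7_of_prop26 BIJL2018_prop26_holds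

end Literature.Barriers.ValiantsHypothesis

end
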